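import Summits.Ventures.Crystal3D.Bulk.CapX2Dense
import HarnessLib

/-!
# X2 certificates: inequality (I) by a CHUNKED kernel check (for certificates too large for one `decide`)

HONEST FRAMING. Venture `Summits/Ventures/Crystal3D` (cell `pub-crystal3d`, phase 2; seat p1). Bookkeeping
only. `Bulk/CapX2CheckI.lean` checks (I) `Dtot ≤ M` on `[u₀,1]` in ONE `decide +kernel`, which recomputes the
singles polynomial `Dtot` from the certificate; at `(d, d_X) = (12, 12)` (the level −0.62 certificate) that
single reduction exceeds the per-declaration budget of a direct-mode `lean` (≈ 40 s, the harness memory cap).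
This file splits the same computation into independently checkable pieces:
* block polynomials `capBlock c k = (1-u²)^k Σ_r g_{k,r}(u)²` (cap part, p3's `blockDiagN`) and
  `x2Block c k = (1-u²)^k Σ_r b_{k,r}(-u)²` (the `S22(-u,-u,1)` part), partial sums `partSum f lo n`;
* a CHUNK LIST `[(lo, n, literal), …]` covering `[0, K)` consecutively (`covers`), each literal certified equal
  (up to zero padding, `eqv1` of `Bulk/CapX2Dense.lean`) to its partial sum by ITS OWN theorem, and
  `eval_sumLits_of_chunks`: the sum of the literals evaluates to `Σ_{k<K}` of the blocks;
* `ineqI_of_chunks`: cap chunks + X2 chunks + a literal for the (cheap) `S12(1,-u,-u)` part + the Taylor-form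
  chain `checkCover` on the assembled literal ⇒ `c.IneqI M`.
Nothing about (II)/(III).
-/

open Finset
open Literature.Geometry.DiscreteGeometry Literature.Geometry.DiscreteGeometry.BachocVallentin
open Summit.Ventures.Crystal3D.CapCut

namespace Summit.Ventures.Crystal3D.CapX2

/-! ### Block polynomials and partial sums -/

/-- The `k`-th cap diagonal block `(1-u²)^k Σ_{r<R} g_{k,r}(u)²` as a coefficient list. -/
def capBlock (c : X2Cert) (k : ℕ) : List ℚ := pmul (ppow [1, 0, -1] k) (blockDiagN c.cap k c.cap.R)

/-- Semantics of `capBlock`. -/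
theorem eval_capBlock (c : X2Cert) (k : ℕ) (u : ℝ) :
    upolyEval (capBlock c k) u = (1 - u ^ 2) ^ k * ∑ r ∈ range c.cap.R, c.cap.g k r u ^ 2 := by
  rw [capBlock, eval_pmul, eval_ppow, eval_blockDiagN]
  have h1 : upolyEval [1, 0, -1] u = 1 - u ^ 2 := by simp [upolyEval]; ring
  rw [h1]

/-- The `k`-th X2 diagonal block `(1-u²)^k Σ_{r<RX} b_{k,r}(-u)²` as a coefficient list. -/
def x2Block (c : X2Cert) (k : ℕ) : List ℚ := pmul (ppow [1, 0, -1] k) (s22BlockN c k c.RX)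

/-- Semantics of `x2Block`. -/
theorem eval_x2Block (c : X2Cert) (k : ℕ) (u : ℝ) :
    upolyEval (x2Block c k) u = (1 - u ^ 2) ^ k * ∑ r ∈ range c.RX, c.b k r (-u) ^ 2 := by
  rw [x2Block, eval_pmul, eval_ppow, eval_s22BlockN]
  have h1 : upolyEval [1, 0, -1] u = 1 - u ^ 2 := by simp [upolyEval]; ring
  rw [h1]

/-- Partial sum `Σ_{lo ≤ k < lo + n} f k` of a family of coefficient lists. -/
def partSum (f : ℕ → List ℚ) (lo : ℕ) : ℕ → List ℚ
  | 0 => []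
  | n + 1 => padd (partSum f lo n) (f (lo + n))

/-- Semantics of `partSum`. -/
theorem eval_partSum (f : ℕ → List ℚ) (lo n : ℕ) (u : ℝ) :
    upolyEval (partSum f lo n) u = ∑ i ∈ range n, upolyEval (f (lo + i)) u := by
  induction n with
  | zero => simp [partSum, upolyEval]
  | succ n ih => rw [partSum, eval_padd, ih, Finset.sum_range_succ]

/-! ### Chunk lists -/

/-- A chunk list `[(lo, n, literal), …]` covers `[cur, K)` consecutively. -/
def covers : List (ℕ × ℕ × List ℚ) → ℕ → ℕ → Bool
  | [], cur, K => decide (cur = K)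
  | ch :: rest, cur, K => decide (ch.1 = cur) && covers rest (cur + ch.2.1) K

/-- Sum of the literals of a chunk list. -/
def sumLits : List (ℕ × ℕ × List ℚ) → List ℚ
  | [] => []
  | ch :: rest => padd ch.2.2 (sumLits rest)

/-- A covering chunk list starts at most at its end. -/
private theorem le_of_covers : ∀ (chunks : List (ℕ × ℕ × List ℚ)) (cur K : ℕ),
    covers chunks cur K = true → cur ≤ K
  | [], cur, K, h => by simp [covers] at h; omega
  | ch :: rest, cur, K, h => by
    simp only [covers, Bool.and_eq_true, decide_eq_true_eq] at h
    have := le_of_covers rest (cur + ch.2.1) K h.2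
    omega

/-- **The literals of a certified covering chunk list sum to `Σ_{cur ≤ k < K} f k`** (each literal being
`eqv1`-equal to its partial sum — one theorem per chunk). -/
theorem eval_sumLits_of_chunks (f : ℕ → List ℚ) :
    ∀ (chunks : List (ℕ × ℕ × List ℚ)) (cur K : ℕ), covers chunks cur K = true →
      (∀ ch ∈ chunks, eqv1 ch.2.2 (partSum f ch.1 ch.2.1) = true) →
      ∀ u : ℝ, upolyEval (sumLits chunks) u = ∑ i ∈ Finset.Ico cur K, upolyEval (f i) u
  | [], cur, K, hcov, _, u => by
    simp only [covers, decide_eq_true_eq] at hcov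
    subst hcov; simp [sumLits, upolyEval]
  | ch :: rest, cur, K, hcov, hok, u => by
    simp only [covers, Bool.and_eq_true, decide_eq_true_eq] at hcov
    obtain ⟨hlo, hrest⟩ := hcov
    have hle : cur + ch.2.1 ≤ K := le_of_covers rest _ K hrest
    have hch := hok ch (by simp)
    have ih := eval_sumLits_of_chunks f rest (cur + ch.2.1) K hrest
      (fun ch' h' => hok ch' (by simp [h'])) u
    rw [sumLits, eval_padd, ih, eval_congr_of_eqv1 _ _ hch u, eval_partSum, hlo,
      ← Finset.sum_Ico_consecutive _ (Nat.le_add_right cur ch.2.1) hle]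
    congr 1
    rw [Finset.sum_Ico_eq_sum_range, Nat.add_sub_cancel_left]

/-! ### (I) from chunks -/

/-- **(I) by a chunked kernel check**: literals for the cap blocks (chunk list covering `[0, |L|)`), for
the X2 diagonal blocks (covering `[0, KX)`), and for the `S12(1,-u,-u)` polynomial, each certified by `eqv1`
against the certificate's own block computations (separate `decide +kernel` theorems), plus a passing
Taylor-form chain on `M − (cap + S11(1,1,1) + 2·S12 + S22)` assembled from the literals ⇒ `c.IneqI M`. -/
theorem ineqI_of_chunks (c : X2Cert) (M : ℚ) (pts : List ℚ)
    (capCh x2Ch : List (ℕ × ℕ × List ℚ)) (dS12 : List ℚ)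
    (hcov1 : covers capCh 0 c.cap.L.length = true)
    (hok1 : ∀ ch ∈ capCh, eqv1 ch.2.2 (partSum (capBlock c) ch.1 ch.2.1) = true)
    (hcov2 : covers x2Ch 0 c.KX = true)
    (hok2 : ∀ ch ∈ x2Ch, eqv1 ch.2.2 (partSum (x2Block c) ch.1 ch.2.1) = true)
    (h12 : eqv1 dS12 (s12PolyN c c.KX) = true)
    (h : checkCover (padd [M] (pscale (-1)
      (padd (sumLits capCh) (padd [s111N c c.KX] (padd (pscale 2 dS12) (sumLits x2Ch))))))
      c.u0 pts 1 = true) :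
    c.IneqI M := by
  intro u hu0 hu1
  have h0 := nonneg_of_checkCover _ pts c.u0 1 h u hu0 (by exact_mod_cast hu1)
  rw [eval_padd, eval_pscale, eval_padd, eval_padd, eval_padd, eval_pscale,
    eval_sumLits_of_chunks _ _ 0 _ hcov1 hok1, eval_sumLits_of_chunks _ _ 0 _ hcov2 hok2,
    eval_congr_of_eqv1 _ _ h12] at h0
  have e1 : ∑ i ∈ Finset.Ico 0 c.cap.L.length, upolyEval (capBlock c i) u = c.cap.kernel u u 1 := by
    rw [CapCert.kernel_diag, Nat.Ico_zero_eq_range]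
    exact Finset.sum_congr rfl fun k _ => eval_capBlock c k u
  have e2 : ∑ i ∈ Finset.Ico 0 c.KX, upolyEval (x2Block c i) u = c.S22 (-u) (-u) 1 := by
    unfold X2Cert.S22 poleKernel3
    rw [Nat.Ico_zero_eq_range]
    refine Finset.sum_congr rfl fun k _ => ?_
    rw [eval_x2Block, Q3_diag, Finset.mul_sum]
    refine Finset.sum_congr rfl fun r _ => ?_
    rw [neg_sq]; ring
  have e3 : upolyEval (s12PolyN c c.KX) u = c.S12 1 (-u) (-u) := by
    rw [eval_s12PolyN]; rfl
  have e4 : ((s111N c c.KX : ℚ) : ℝ) = c.S11 1 1 1 := by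
    rw [cast_s111N]; rfl
  have hd : c.diagTot u = c.cap.kernel u u 1 + c.S11 1 1 1 + 2 * c.S12 1 (-u) (-u)
      + c.S22 (-u) (-u) 1 := rfl
  rw [hd, ← e1, ← e2, ← e3, ← e4]
  simp only [Nat.Ico_zero_eq_range]
  simp [upolyEval] at h0
  linarith

end Summit.Ventures.Crystal3D.CapX2
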